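import Summits.QuantumFields.YangMills.Theorems.BalabanUVNodesN19TargetClassWeightsE1
import Summits.QuantumFields.YangMills.Theorems.BalabanUVNodesN19TargetClassWeightsAtLiveRecord
import Literature.MathematicalPhysics.QuantumFieldTheory.Balaban1983to89.Node00.TwoRunSiteTransport
import Literature.MathematicalPhysics.QuantumFieldTheory.Balaban1983to89.Node00.Record13LettersOfThm1CCMW

/-!
# BalabanUVNodes ∕ N19 (NE7) — node U5's :183 road for F3's class weights AT NODE U5d's `RAgree`-TRUNCATION (option (c) of `Node00/TwoRunSiteTransport`):
# run A's TERM weights against run B's PARTIAL SUMS over the block-down fibres, EVERY LAW DISCHARGED at the ₁₃ live re-pins — the honest two-run NE7 shape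

Cell `pub-ymgap` (HUMAN RULING D-0062, Track A), R134 seat `pub-ymgap-dag-n19-d` (gen 17), strategy s2 «by-name knit»; lane = dag-lead g11 LANE WORD l.21525 (the MGF road's
AT-RECORD seat); trigger (t3′) = dag-n20-d g26 ∕ g27 `Node00/TwoRunSiteTransport` (p561554) ∕ OFFER-KEY `Node00/TwoRunSiteKey`.  Filed `--kind proof --supports
stmt-QuantumFields-20544 --as helper` (K3⁷ `SpineGivenEndpointR13SepCoPH`); COUNT-NEUTRAL.  Sibling of modules B″ `…N19TargetClassWeightsE1` (p553397), B‴ `…E1Keyed` (p562886),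
B⁗ `…AtLiveRecord` (p566249).  [III] = [Balaban1988Convergent], [LF-I] = [Balaban1989LargeFieldI], [LF-II] = [Balaban1989LargeFieldII].

WHY THIS FILE.  Module B″ states N19's :183 road (∃δ-edge form) for term data READ OFF NODE 00's dressed class weights — run A's classes = its (2.18) sequences of record at
cutoff `K₀ + K` (full length), run A's term weight = `classWeightOfDatum₉`, run B's term weight on a run-A class `s` = the SUM of run B's class weights (cutoff `K₀ + K + 1`) over
the fibre `{s' : tr K s' = s}` of a truncation map `tr K` of run B's sequences INTO RUN A's ADMISSIBLE SEQUENCES — with `tr` a PARAMETER (node U5d's object) and six LAW binders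
displayed (`hsel`, (H-U), (H-ζ), `0 ≤ ζ`, `IsZetaAbsLeOne`, `IsZetaUnity`).  Two things have happened since: (i) module B⁗ showed that AT EVERY ₁₃ LIVE RE-PIN `θ.liveRepin₁₃ F N`
of a Stage-13 parameter carrying K0b's residuals of record (`hres : θ.HasResidualsOfRecord F N`) all six laws are THEOREMS (K0a `liveRepin₁₃_ppSel` · K0c ABSOLUTE
`localBgMeasurable` · K0b ∕ K0c ζ-laws); (ii) dag-n20-d TYPED node U5d's truncation (`Node00/TwoRunSiteTransport`, p561554): «drop run B's level-1 entry, block the others down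
by `L`» IS a map `truncSeq F ν hM hR : Seq (𝐃^B, (K+1)-torus) (k+1) → Seq (𝐃^A, K-torus) k` into run A's ADMISSIBLE sequences EXACTLY WHEN the displayed flow hypothesis
`RAgree F ν gA gB k` (equality of the (2.5) cube factors `R(g^B_{j+1}) = R(g^A_j)` on the window) holds — option (c) of the definer's (a)∕(b)∕(c) list.  THIS FILE instantiates
B″ at both: the law binders are discharged at the re-pin (§1, for ANY `tr`), and `tr K := truncSeq F θ.ν hM (hR K)` (§2) for run families whose cutoff field is DEFINITIONALLY
`K₀ + K` ∕ `K₀ + K + 1` (built `⟨K₀ + K, mA K, cA K⟩ ∕ ⟨K₀ + K + 1, mB K, cB K⟩ : B12.RunParams`, so no transport along a cutoff equation is needed).  What N19's face then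
DISPLAYS is: `hres`, `hM : 0 < θ.τ9.M` ([I]'s basic cube size is positive), the flow hypothesis `hR : ∀ K, RAgree F θ.ν (gA K) (gB K) (K₀ + K)`, run bookkeeping
(`D hD g₀ os K₀ mA mB cA cB gA gB`, history starts `hgA hgB`), `0 ≤ l₀`, `0 < vol`, and THE FOUR SPINE ESTIMATES — N20's `RelWeightBound` (`h20`), N21's `ShellWeightBound`
(`h21`), U4′'s `W + Wsh < 1` (`hlt`), N19's ∃δ-edge `∃ δ, NE7.Core … δ ∧ Summable δ` (`hedge`; NOT PRINTED for `d = 4`) — over THE HONEST TWO-RUN TERM DATA: `A K t ⟨K', s⟩ =`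
run A's (2.18) TERM weight of `s`, `B K t ⟨K', s⟩ = Σ_{s' : truncSeq s' = s}` run B's (2.18) term weights (node U5d's partial summation «into run A's classes»).  The flow-free
sibling (option (b): dag-n20-d's coupling-free site keys `twoRunKeyA ∕ twoRunKeyB`, no `hR`) is module B⁵ `…N19TargetClassWeightsTwoRunKeyed`; under `hR` the two commute.

CONTENT (theorems only):
* §1 LAW-FREE B″ AT ANY ₁₃ LIVE RE-PIN (generic truncation `tr`): ★ `matching_scheme_of_coreEdge_classWeights_liveRepin₁₃` (B″ §1's road with `hsel` ∕ `hU` ∕ `hζm` ∕ `hζ0` ∕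
  `hζ1` ∕ `hζu` DISCHARGED; binders = `hres`, `D hD g₀ os`, runs + cutoffs + history starts, `tr`, `l₀ vol`, `h20 h21 hlt hedge`) · `matching_datumOfRecord₁₃CoPH_liveRepin₁₃_door_of_coreEdge_classWeights`
  (the same at the re-pin's OWN v1.7 datum through the history-blind cured door, ANY proviso proof `h`; B1 `isPrintedAveraged_datumOfRecord₁₃CoPH` BY NAME).
* §2 AT NODE U5d's `RAgree`-TRUNCATION: ★★ `matching_scheme_of_coreEdge_classWeights_truncSeq_liveRepin₁₃` (`tr K := truncSeq F θ.ν hM (hR K)`; displayed `hM`, `hR`).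
* §3 AT THE WITNESSES: ★★ `matching_scheme_of_coreEdge_classWeights_truncSeq_theta13LiveOfRecord` (the Stage-13 witness of record; `hM` DISCHARGED — its basic cube size is `1`) ·
  `matching_datumOfRecord₁₃CoPH_theta13LiveOfRecord_door_of_coreEdge_classWeights_truncSeq` (NODE 00's CLOSED v1.7 datum of record, dag-n11-e's door proof) ·
  `matching_scheme_of_coreEdge_classWeights_truncSeq_theta13OfThm1CCMW` (dag-n21-c's windowed collared K0⁷ witness; `hM` DISCHARGED — cube size `L^j`, dag-n21-c's `τ9_M_pos_theta13OfThm1CCMW` BY NAME).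

HONEST FRAMING.  Count-neutral kernel bookkeeping: module B″ composed BY NAME with module B⁗'s law discharges and dag-n20-d's typed truncation.  It proves NO estimate: NE7 ∕ NE7b ∕
NE7c are NOT PRINTED for `d = 4` and NOT proved here (`h20` ∕ `h21` ∕ `hlt` ∕ `hedge` remain HYPOTHESES and are the nodes' content); the flow hypothesis `RAgree` is DISPLAYED,
not proved (it is a statement about the (2.5) letters `R_k` of two coupling histories; the definer's (a)∕(b)∕(c) word is not prejudged — option (b) needs none); nothing of
Bałaban's is asserted; N19 ∕ N20 ∕ N21 ∕ N27 NOT discharged; no K-item closes; counts unmoved (typed 28∕28 · discharged 5∕27).  One finite `𝕋⁴_{L^K}` programme at fixed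
`ε = L^{−K}` along two consecutive cutoffs; NOT ℝ⁴, NOT OS, NOT a mass gap, NOT Clay.  No `instance`, no `notation`, no `def`.  Decidability instances in the statements are the
classical ones (`open Classical`), as in B″.
Sources (bookkeeping locators): [III] (2.1) p.254, (2.5) p.255, (2.18) p.257, (3.16) p.268, (3.24)–(3.25) p.270; [LF-I] (0.2)–(0.4) p.176; [LF-II] Thm 1 + (0.1) pp.355–356;
[Balaban1985UV3] (6) p.257; [King1986] (3.10) p.656; [Balaban1987RG1] §0 (0.1) p.251 (run parameters), Thm 1 p.255.
-/

noncomputable section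

namespace Summit.QuantumFields.YangMills.BalabanUVNodes.N19TargetClassWeightsTruncSeq

open MeasureTheory
open scoped BigOperators Matrix.Norms.L2Operator
open Literature.MathematicalPhysics.QuantumFieldTheory.Balaban1983to89
open Literature.MathematicalPhysics.QuantumFieldTheory.Balaban1983to89.Node00
open T4Continuum B14.Eq218Concrete
open T4WeightBudget (RelWeightBound)
open T4IndicatorShell (ShellWeightBound)
open T4CauchySum (MatchingModConstants)
open Summit.QuantumFields.BalabanUV.T4Continuum.Spine
open Summit.QuantumFields.YangMills.BalabanUVNodes.N19TargetClassWeightsE1 (matching_scheme_of_coreEdge_classWeights)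
open Summit.QuantumFields.YangMills.BalabanUVNodes.N19TargetClassWeightsAtLiveRecord
  (zeta_liveRepin₁₃_nonneg_of_hasResiduals zetaMeasurable_liveRepin₁₃_of_hasResiduals)

variable (F : T4Family) (N : ℕ) [NeZero N]

/-! ## §1 LAW-FREE B″ AT ANY ₁₃ LIVE RE-PIN `θ.liveRepin₁₃ F N` CARRYING K0b's RESIDUALS (generic truncation map `tr`) -/

section LiveRepin

variable (θ : Stage13Params F N)

open Classical in
/-- **★ N19's :183 ROAD (∃δ-EDGE FORM) FOR CLASS-WEIGHT TERM DATA ALONG ANY TRUNCATION MAP, AT THE RE-PIN, EVERY LAW DISCHARGED.**  At ANY datum `D` with measurable averaging,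
for runs `pA K` ∕ `pB K` at cutoffs `K₀ + K` ∕ `K₀ + K + 1` whose histories start at the dressing's coupling and ANY truncation map `tr K` of run B's sequences of record into run
A's (node U5d's object): N20's `RelWeightBound`, N21's `ShellWeightBound`, U4′'s `W + Wsh < 1` and N19's ∃δ-edge FOR THE TERM DATA READ OFF NODE 00 at the re-pin (`A` = run A's
class = term weights, `B` = run B's fibre sums along `tr`) ⇒ `∃ δ′, Summable δ′ ∧ MatchingModConstants vol l₀ δ′ (schemeZ (D.scheme g₀) os)`.  Module B″
`matching_scheme_of_coreEdge_classWeights` at `ϑ := (θ.liveRepin₁₃ F N).toStage9Params`, `E := EOfRecord₁₃ F N θ`, with `hsel := liveRepin₁₃_ppSel` (`rfl`), `hU` := K0c's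
ABSOLUTE `localBgMeasurable`, `hζm` ∕ `hζ0` := module B⁗ §1, `hζ1` ∕ `hζu := (HasResidualsOfRecord.liveRepin₁₃ hres).zetaAbs ∕ .zetaUnity`.  DISPLAYED: `hres`, bookkeeping, `tr`, and
the four ESTIMATES only. [cite: Balaban1985UV3, (6) p.257; Balaban1989LargeFieldII, Thm 1 + (0.1) pp.355–356; King1986, (3.10) p.656; Balaban1988Convergent, (2.18) p.257, (3.16) p.268; Balaban1989LargeFieldI, (0.3)–(0.4) p.176 (bookkeeping)] -/
theorem matching_scheme_of_coreEdge_classWeights_liveRepin₁₃ (hres : θ.HasResidualsOfRecord F N)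
    (D : FiniteEpsData F (SU N)) (hD : D.AvgMeasurable) (g₀ : ℕ → ℝ) (os : List (ULoop F)) {K₀ : ℕ} (pA pB : ℕ → B12.RunParams) (gA gB : ℕ → ℕ → ℝ)
    (hKA : ∀ K, (pA K).K = K₀ + K) (hKB : ∀ K, (pB K).K = K₀ + K + 1) (hgA : ∀ K, gA K 0 = g₀ (pA K).K) (hgB : ∀ K, gB K 0 = g₀ (pB K).K)
    (tr : (K : ℕ) → SeqOfRecord F θ.ν θ.τ9.M (gB K) (pB K).K (pB K).K → SeqOfRecord F θ.ν θ.τ9.M (gA K) (pA K).K (pA K).K)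
    {l₀ vol : ℝ} (hl₀ : 0 ≤ l₀) (hvol : 0 < vol)
    {shA shB : ℕ → ℝ → (Σ K, SeqOfRecord F θ.ν θ.τ9.M (gA K) (pA K).K (pA K).K) → ℝ}
    {Bad : ℕ → ℝ → Finset (Σ K, SeqOfRecord F θ.ν θ.τ9.M (gA K) (pA K).K (pA K).K)} {W Wsh : ℕ → ℝ}
    (h20 : RelWeightBound l₀
      (fun K => (Finset.univ : Finset (SeqOfRecord F θ.ν θ.τ9.M (gA K) (pA K).K (pA K).K)).map
        (Function.Embedding.sigmaMk (β := fun K' => SeqOfRecord F θ.ν θ.τ9.M (gA K') (pA K').K (pA K').K) K))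
      (fun _ t x => classWeightOfDatum₉ F N (θ.liveRepin₁₃ F N).toStage9Params D g₀ os (pA x.1) (gA x.1) (pA x.1).K t x.2)
      (fun _ t x => ∑ s' ∈ Finset.univ.filter (fun s' : SeqOfRecord F θ.ν θ.τ9.M (gB x.1) (pB x.1).K (pB x.1).K => tr x.1 s' = x.2),
        classWeightOfDatum₉ F N (θ.liveRepin₁₃ F N).toStage9Params D g₀ os (pB x.1) (gB x.1) (pB x.1).K t s') Bad W)
    (h21 : ShellWeightBound l₀
      (fun K => (Finset.univ : Finset (SeqOfRecord F θ.ν θ.τ9.M (gA K) (pA K).K (pA K).K)).map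
        (Function.Embedding.sigmaMk (β := fun K' => SeqOfRecord F θ.ν θ.τ9.M (gA K') (pA K').K (pA K').K) K))
      (fun _ t x => classWeightOfDatum₉ F N (θ.liveRepin₁₃ F N).toStage9Params D g₀ os (pA x.1) (gA x.1) (pA x.1).K t x.2)
      (fun _ t x => ∑ s' ∈ Finset.univ.filter (fun s' : SeqOfRecord F θ.ν θ.τ9.M (gB x.1) (pB x.1).K (pB x.1).K => tr x.1 s' = x.2),
        classWeightOfDatum₉ F N (θ.liveRepin₁₃ F N).toStage9Params D g₀ os (pB x.1) (gB x.1) (pB x.1).K t s') shA shB Wsh)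
    (hlt : ∀ K, W K + Wsh K < 1)
    (hedge : ∃ δ : ℕ → ℝ, NE7.Core l₀ vol
      (fun K => (Finset.univ : Finset (SeqOfRecord F θ.ν θ.τ9.M (gA K) (pA K).K (pA K).K)).map
        (Function.Embedding.sigmaMk (β := fun K' => SeqOfRecord F θ.ν θ.τ9.M (gA K') (pA K').K (pA K').K) K)) Bad
      (fun K t x => classWeightOfDatum₉ F N (θ.liveRepin₁₃ F N).toStage9Params D g₀ os (pA x.1) (gA x.1) (pA x.1).K t x.2 - shA K t x)
      (fun K t x => (∑ s' ∈ Finset.univ.filter (fun s' : SeqOfRecord F θ.ν θ.τ9.M (gB x.1) (pB x.1).K (pB x.1).K => tr x.1 s' = x.2),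
        classWeightOfDatum₉ F N (θ.liveRepin₁₃ F N).toStage9Params D g₀ os (pB x.1) (gB x.1) (pB x.1).K t s') - shB K t x) δ ∧ Summable δ) :
    ∃ δ' : ℕ → ℝ, Summable δ' ∧ MatchingModConstants vol l₀ δ' (T4GenFunBounds.schemeZ (D.scheme g₀) os) :=
  matching_scheme_of_coreEdge_classWeights (θ.liveRepin₁₃ F N).toStage9Params (EOfRecord₁₃ F N θ)
    (Stage13Params.liveRepin₁₃_ppSel F N θ) (localBgMeasurable F N _) (zetaMeasurable_liveRepin₁₃_of_hasResiduals F N θ hres)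
    (zeta_liveRepin₁₃_nonneg_of_hasResiduals F N θ hres) (Stage13Params.HasResidualsOfRecord.liveRepin₁₃ hres).zetaAbs
    (Stage13Params.HasResidualsOfRecord.liveRepin₁₃ hres).zetaUnity D hD g₀ os pA pB gA gB hKA hKB hgA hgB tr hl₀ hvol h20 h21 hlt hedge

open Classical in
/-- **★ N19's :183 ROAD ALONG ANY TRUNCATION MAP AT THE RE-PIN'S OWN v1.7 DATUM OF RECORD, EVERY LAW ∕ ROW ∕ SELECTOR BINDER DISCHARGED** — §1's road at
`D := datumOfRecord₁₃CoPH F N (ofHistoryBlind (ofCured (θ.liveRepin₁₃ F N))) h` through the history-blind cured door (def-T FILE 27 ∕ K0a FILE 18), for ANY proof `h` of the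
door's core provisos (inhabited, given `hres`, by `(Stage13Params.provisos₁₃Core_liveRepin₁₃_of_hasResiduals hres).ofCured.ofHistoryBlind`); the datum's measurable averaging is B1
`isPrintedAveraged_datumOfRecord₁₃CoPH` BY NAME. [cite: Balaban1985UV3, (6) p.257; Balaban1989LargeFieldII, Thm 1 + (0.1) pp.355–356; King1986, (3.10) p.656; Balaban1988Convergent, (2.18) p.257 (bookkeeping)] -/
theorem matching_datumOfRecord₁₃CoPH_liveRepin₁₃_door_of_coreEdge_classWeights (hres : θ.HasResidualsOfRecord F N)
    (h : (Stage13HParams.ofHistoryBlind F N (Stage13RParams.ofCured F N (θ.liveRepin₁₃ F N))).Provisos₁₃CoPH F N)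
    (g₀ : ℕ → ℝ) (os : List (ULoop F)) {K₀ : ℕ} (pA pB : ℕ → B12.RunParams) (gA gB : ℕ → ℕ → ℝ)
    (hKA : ∀ K, (pA K).K = K₀ + K) (hKB : ∀ K, (pB K).K = K₀ + K + 1) (hgA : ∀ K, gA K 0 = g₀ (pA K).K) (hgB : ∀ K, gB K 0 = g₀ (pB K).K)
    (tr : (K : ℕ) → SeqOfRecord F θ.ν θ.τ9.M (gB K) (pB K).K (pB K).K → SeqOfRecord F θ.ν θ.τ9.M (gA K) (pA K).K (pA K).K)
    {l₀ vol : ℝ} (hl₀ : 0 ≤ l₀) (hvol : 0 < vol)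
    {shA shB : ℕ → ℝ → (Σ K, SeqOfRecord F θ.ν θ.τ9.M (gA K) (pA K).K (pA K).K) → ℝ}
    {Bad : ℕ → ℝ → Finset (Σ K, SeqOfRecord F θ.ν θ.τ9.M (gA K) (pA K).K (pA K).K)} {W Wsh : ℕ → ℝ}
    (h20 : RelWeightBound l₀
      (fun K => (Finset.univ : Finset (SeqOfRecord F θ.ν θ.τ9.M (gA K) (pA K).K (pA K).K)).map
        (Function.Embedding.sigmaMk (β := fun K' => SeqOfRecord F θ.ν θ.τ9.M (gA K') (pA K').K (pA K').K) K))
      (fun _ t x => classWeightOfDatum₉ F N (θ.liveRepin₁₃ F N).toStage9Params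
        (datumOfRecord₁₃CoPH F N (Stage13HParams.ofHistoryBlind F N (Stage13RParams.ofCured F N (θ.liveRepin₁₃ F N))) h) g₀ os (pA x.1) (gA x.1) (pA x.1).K t x.2)
      (fun _ t x => ∑ s' ∈ Finset.univ.filter (fun s' : SeqOfRecord F θ.ν θ.τ9.M (gB x.1) (pB x.1).K (pB x.1).K => tr x.1 s' = x.2),
        classWeightOfDatum₉ F N (θ.liveRepin₁₃ F N).toStage9Params
          (datumOfRecord₁₃CoPH F N (Stage13HParams.ofHistoryBlind F N (Stage13RParams.ofCured F N (θ.liveRepin₁₃ F N))) h) g₀ os (pB x.1) (gB x.1) (pB x.1).K t s') Bad W)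
    (h21 : ShellWeightBound l₀
      (fun K => (Finset.univ : Finset (SeqOfRecord F θ.ν θ.τ9.M (gA K) (pA K).K (pA K).K)).map
        (Function.Embedding.sigmaMk (β := fun K' => SeqOfRecord F θ.ν θ.τ9.M (gA K') (pA K').K (pA K').K) K))
      (fun _ t x => classWeightOfDatum₉ F N (θ.liveRepin₁₃ F N).toStage9Params
        (datumOfRecord₁₃CoPH F N (Stage13HParams.ofHistoryBlind F N (Stage13RParams.ofCured F N (θ.liveRepin₁₃ F N))) h) g₀ os (pA x.1) (gA x.1) (pA x.1).K t x.2)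
      (fun _ t x => ∑ s' ∈ Finset.univ.filter (fun s' : SeqOfRecord F θ.ν θ.τ9.M (gB x.1) (pB x.1).K (pB x.1).K => tr x.1 s' = x.2),
        classWeightOfDatum₉ F N (θ.liveRepin₁₃ F N).toStage9Params
          (datumOfRecord₁₃CoPH F N (Stage13HParams.ofHistoryBlind F N (Stage13RParams.ofCured F N (θ.liveRepin₁₃ F N))) h) g₀ os (pB x.1) (gB x.1) (pB x.1).K t s') shA shB Wsh)
    (hlt : ∀ K, W K + Wsh K < 1)
    (hedge : ∃ δ : ℕ → ℝ, NE7.Core l₀ vol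
      (fun K => (Finset.univ : Finset (SeqOfRecord F θ.ν θ.τ9.M (gA K) (pA K).K (pA K).K)).map
        (Function.Embedding.sigmaMk (β := fun K' => SeqOfRecord F θ.ν θ.τ9.M (gA K') (pA K').K (pA K').K) K)) Bad
      (fun K t x => classWeightOfDatum₉ F N (θ.liveRepin₁₃ F N).toStage9Params
        (datumOfRecord₁₃CoPH F N (Stage13HParams.ofHistoryBlind F N (Stage13RParams.ofCured F N (θ.liveRepin₁₃ F N))) h) g₀ os (pA x.1) (gA x.1) (pA x.1).K t x.2 - shA K t x)
      (fun K t x => (∑ s' ∈ Finset.univ.filter (fun s' : SeqOfRecord F θ.ν θ.τ9.M (gB x.1) (pB x.1).K (pB x.1).K => tr x.1 s' = x.2),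
        classWeightOfDatum₉ F N (θ.liveRepin₁₃ F N).toStage9Params
          (datumOfRecord₁₃CoPH F N (Stage13HParams.ofHistoryBlind F N (Stage13RParams.ofCured F N (θ.liveRepin₁₃ F N))) h) g₀ os (pB x.1) (gB x.1) (pB x.1).K t s') - shB K t x)
        δ ∧ Summable δ) :
    ∃ δ' : ℕ → ℝ, Summable δ' ∧
      MatchingModConstants vol l₀ δ'
        (T4GenFunBounds.schemeZ ((datumOfRecord₁₃CoPH F N (Stage13HParams.ofHistoryBlind F N (Stage13RParams.ofCured F N (θ.liveRepin₁₃ F N))) h).scheme g₀) os) :=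
  matching_scheme_of_coreEdge_classWeights_liveRepin₁₃ F N θ hres _ (isPrintedAveraged_datumOfRecord₁₃CoPH F N _ h).avgMeasurable
    g₀ os pA pB gA gB hKA hKB hgA hgB tr hl₀ hvol h20 h21 hlt hedge

/-! ## §2 AT NODE U5d's `RAgree`-TRUNCATION `truncSeq` (option (c) of `Node00/TwoRunSiteTransport`): run families `⟨K₀ + K, mA K, cA K⟩ ∕ ⟨K₀ + K + 1, mB K, cB K⟩`, displayed
`hM : 0 < θ.τ9.M` and `hR : ∀ K, RAgree F θ.ν (gA K) (gB K) (K₀ + K)`; run B's term weight on run A's class `s` = Σ over `{s' : truncSeq s' = s}` -/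

open Classical in
/-- **★★ N19's :183 ROAD FOR F3's CLASS WEIGHTS AT NODE U5d's `RAgree`-TRUNCATION, AT THE RE-PIN, EVERY LAW DISCHARGED — THE HONEST TWO-RUN NE7 SHAPE.**  For the run families
`K ↦ ⟨K₀ + K, mA K, cA K⟩` (run A, cutoff `K₀ + K`) and `K ↦ ⟨K₀ + K + 1, mB K, cB K⟩` (run B, cutoff `K₀ + K + 1`) with coupling histories `gA K` ∕ `gB K` starting at the
dressing's coupling, [I]'s basic cube size positive (`hM`) and the DISPLAYED flow hypothesis `hR` (the (2.5) cube factors of the two histories agree on every window — what makes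
«drop level 1, block down by `L`» land in run A's admissible (2.18) sequences): IF N20's `RelWeightBound`, N21's `ShellWeightBound`, U4′'s `W + Wsh < 1` and N19's ∃δ-edge hold FOR
THE TERM DATA `A K t ⟨K', s⟩ :=` run A's (2.18) TERM weight `classWeightOfDatum₉ … ⟨K₀ + K', …⟩ (gA K') (K₀ + K') t s`, `B K t ⟨K', s⟩ := Σ_{s' : truncSeq F θ.ν hM (hR K') s' = s}`
run B's (2.18) term weights at cutoff `K₀ + K' + 1` (node U5d's PARTIAL SUMMATION over the block-down fibres), THEN `∃ δ′, Summable δ′ ∧ MatchingModConstants vol l₀ δ′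
(schemeZ (D.scheme g₀) os)`.  §1 at `tr K := truncSeq F θ.ν hM (hR K)`, the cutoff equations being `rfl`.  DISPLAYED: `hres hM hR`, `D hD g₀ os`, `mA mB cA cB gA gB hgA hgB`,
`hl₀ hvol`, and THE FOUR ESTIMATES `h20` (N20) ∕ `h21` (N21) ∕ `hlt` (U4′) ∕ `hedge` (NE7's ∃δ-edge, NOT PRINTED for `d = 4`) — nothing else.
[cite: Balaban1985UV3, (6) p.257; Balaban1989LargeFieldII, Thm 1 + (0.1) pp.355–356; Balaban1989LargeFieldI, (0.2)–(0.4) p.176; Balaban1988Convergent, (2.1) p.254, (2.5) p.255, (2.18) p.257; King1986, (3.10) p.656; Balaban1987RG1, (0.1) p.251 (bookkeeping)] -/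
theorem matching_scheme_of_coreEdge_classWeights_truncSeq_liveRepin₁₃ (hres : θ.HasResidualsOfRecord F N) (hM : 0 < θ.τ9.M)
    (D : FiniteEpsData F (SU N)) (hD : D.AvgMeasurable) (g₀ : ℕ → ℝ) (os : List (ULoop F)) (K₀ : ℕ) (mA mB : ℕ → ℕ) (cA cB : ℕ → ℝ) (gA gB : ℕ → ℕ → ℝ)
    (hgA : ∀ K, gA K 0 = g₀ (K₀ + K)) (hgB : ∀ K, gB K 0 = g₀ (K₀ + K + 1)) (hR : ∀ K, RAgree F θ.ν (gA K) (gB K) (K₀ + K))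
    {l₀ vol : ℝ} (hl₀ : 0 ≤ l₀) (hvol : 0 < vol)
    {shA shB : ℕ → ℝ → (Σ K, SeqOfRecord F θ.ν θ.τ9.M (gA K) (K₀ + K) (K₀ + K)) → ℝ}
    {Bad : ℕ → ℝ → Finset (Σ K, SeqOfRecord F θ.ν θ.τ9.M (gA K) (K₀ + K) (K₀ + K))} {W Wsh : ℕ → ℝ}
    (h20 : RelWeightBound l₀
      (fun K => (Finset.univ : Finset (SeqOfRecord F θ.ν θ.τ9.M (gA K) (K₀ + K) (K₀ + K))).map
        (Function.Embedding.sigmaMk (β := fun K' => SeqOfRecord F θ.ν θ.τ9.M (gA K') (K₀ + K') (K₀ + K')) K))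
      (fun _ t x => classWeightOfDatum₉ F N (θ.liveRepin₁₃ F N).toStage9Params D g₀ os ⟨K₀ + x.1, mA x.1, cA x.1⟩ (gA x.1) (K₀ + x.1) t x.2)
      (fun _ t x => ∑ s' ∈ Finset.univ.filter
          (fun s' : SeqOfRecord F θ.ν θ.τ9.M (gB x.1) (K₀ + x.1 + 1) (K₀ + x.1 + 1) => truncSeq F θ.ν hM (hR x.1) s' = x.2),
        classWeightOfDatum₉ F N (θ.liveRepin₁₃ F N).toStage9Params D g₀ os ⟨K₀ + x.1 + 1, mB x.1, cB x.1⟩ (gB x.1) (K₀ + x.1 + 1) t s') Bad W)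
    (h21 : ShellWeightBound l₀
      (fun K => (Finset.univ : Finset (SeqOfRecord F θ.ν θ.τ9.M (gA K) (K₀ + K) (K₀ + K))).map
        (Function.Embedding.sigmaMk (β := fun K' => SeqOfRecord F θ.ν θ.τ9.M (gA K') (K₀ + K') (K₀ + K')) K))
      (fun _ t x => classWeightOfDatum₉ F N (θ.liveRepin₁₃ F N).toStage9Params D g₀ os ⟨K₀ + x.1, mA x.1, cA x.1⟩ (gA x.1) (K₀ + x.1) t x.2)
      (fun _ t x => ∑ s' ∈ Finset.univ.filter
          (fun s' : SeqOfRecord F θ.ν θ.τ9.M (gB x.1) (K₀ + x.1 + 1) (K₀ + x.1 + 1) => truncSeq F θ.ν hM (hR x.1) s' = x.2),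
        classWeightOfDatum₉ F N (θ.liveRepin₁₃ F N).toStage9Params D g₀ os ⟨K₀ + x.1 + 1, mB x.1, cB x.1⟩ (gB x.1) (K₀ + x.1 + 1) t s') shA shB Wsh)
    (hlt : ∀ K, W K + Wsh K < 1)
    (hedge : ∃ δ : ℕ → ℝ, NE7.Core l₀ vol
      (fun K => (Finset.univ : Finset (SeqOfRecord F θ.ν θ.τ9.M (gA K) (K₀ + K) (K₀ + K))).map
        (Function.Embedding.sigmaMk (β := fun K' => SeqOfRecord F θ.ν θ.τ9.M (gA K') (K₀ + K') (K₀ + K')) K)) Bad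
      (fun K t x => classWeightOfDatum₉ F N (θ.liveRepin₁₃ F N).toStage9Params D g₀ os ⟨K₀ + x.1, mA x.1, cA x.1⟩ (gA x.1) (K₀ + x.1) t x.2 - shA K t x)
      (fun K t x => (∑ s' ∈ Finset.univ.filter
          (fun s' : SeqOfRecord F θ.ν θ.τ9.M (gB x.1) (K₀ + x.1 + 1) (K₀ + x.1 + 1) => truncSeq F θ.ν hM (hR x.1) s' = x.2),
        classWeightOfDatum₉ F N (θ.liveRepin₁₃ F N).toStage9Params D g₀ os ⟨K₀ + x.1 + 1, mB x.1, cB x.1⟩ (gB x.1) (K₀ + x.1 + 1) t s') - shB K t x) δ ∧ Summable δ) :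
    ∃ δ' : ℕ → ℝ, Summable δ' ∧ MatchingModConstants vol l₀ δ' (T4GenFunBounds.schemeZ (D.scheme g₀) os) :=
  matching_scheme_of_coreEdge_classWeights_liveRepin₁₃ F N θ hres D hD g₀ os (fun K => ⟨K₀ + K, mA K, cA K⟩) (fun K => ⟨K₀ + K + 1, mB K, cB K⟩) gA gB
    (fun _ => rfl) (fun _ => rfl) hgA hgB (fun K => truncSeq F θ.ν hM (hR K)) hl₀ hvol h20 h21 hlt hedge

end LiveRepin

/-! ## §3 AT THE WITNESSES: the Stage-13 witness of record `theta13LiveOfRecord F N` (basic cube size `1`: `hM` discharged), its CLOSED v1.7 datum of record (dag-n11-e's door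
proof), and dag-n21-c's windowed collared K0⁷ witness `theta13OfThm1CCMW F N j γ ε₀ ε₂₉ B₃ B₃' a₀ a₁` (cube size `L^j`: `hM` discharged) -/

section AtRecord

open Classical in
/-- **★★ N19's :183 ROAD FOR F3's CLASS WEIGHTS AT NODE U5d's `RAgree`-TRUNCATION, AT THE STAGE-13 WITNESS OF RECORD — `hres` AND `hM` DISCHARGED** (`θ₁₃ = theta13LiveOfRecord F N`
is the ₁₃ live re-pin of `theta13OfFamily F N eps0OfRecord₁₃ …` with `hres := hasResidualsOfRecord_theta13OfFamily`, and its basic cube size is `1`, `rfl`).  DISPLAYED: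
`hR`, `D hD g₀ os K₀ mA mB cA cB gA gB hgA hgB`, `hl₀ hvol`, THE FOUR ESTIMATES — nothing else. [cite: Balaban1985UV3, (6) p.257; Balaban1989LargeFieldII, Thm 1 + (0.1) pp.355–356; Balaban1989LargeFieldI, (0.2)–(0.4) p.176; Balaban1988Convergent, (2.5) p.255, (2.18) p.257; King1986, (3.10) p.656 (bookkeeping)] -/
theorem matching_scheme_of_coreEdge_classWeights_truncSeq_theta13LiveOfRecord
    (D : FiniteEpsData F (SU N)) (hD : D.AvgMeasurable) (g₀ : ℕ → ℝ) (os : List (ULoop F)) (K₀ : ℕ) (mA mB : ℕ → ℕ) (cA cB : ℕ → ℝ) (gA gB : ℕ → ℕ → ℝ)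
    (hgA : ∀ K, gA K 0 = g₀ (K₀ + K)) (hgB : ∀ K, gB K 0 = g₀ (K₀ + K + 1))
    (hR : ∀ K, RAgree F (theta13LiveOfRecord F N).ν (gA K) (gB K) (K₀ + K))
    {l₀ vol : ℝ} (hl₀ : 0 ≤ l₀) (hvol : 0 < vol)
    {shA shB : ℕ → ℝ → (Σ K, SeqOfRecord F (theta13LiveOfRecord F N).ν (theta13LiveOfRecord F N).τ9.M (gA K) (K₀ + K) (K₀ + K)) → ℝ}
    {Bad : ℕ → ℝ → Finset (Σ K, SeqOfRecord F (theta13LiveOfRecord F N).ν (theta13LiveOfRecord F N).τ9.M (gA K) (K₀ + K) (K₀ + K))} {W Wsh : ℕ → ℝ}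
    (h20 : RelWeightBound l₀
      (fun K => (Finset.univ : Finset (SeqOfRecord F (theta13LiveOfRecord F N).ν (theta13LiveOfRecord F N).τ9.M (gA K) (K₀ + K) (K₀ + K))).map
        (Function.Embedding.sigmaMk (β := fun K' => SeqOfRecord F (theta13LiveOfRecord F N).ν (theta13LiveOfRecord F N).τ9.M (gA K') (K₀ + K') (K₀ + K')) K))
      (fun _ t x => classWeightOfDatum₉ F N (theta13LiveOfRecord F N).toStage9Params D g₀ os ⟨K₀ + x.1, mA x.1, cA x.1⟩ (gA x.1) (K₀ + x.1) t x.2)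
      (fun _ t x => ∑ s' ∈ Finset.univ.filter
          (fun s' : SeqOfRecord F (theta13LiveOfRecord F N).ν (theta13LiveOfRecord F N).τ9.M (gB x.1) (K₀ + x.1 + 1) (K₀ + x.1 + 1) =>
            truncSeq F (theta13LiveOfRecord F N).ν Nat.one_pos (hR x.1) s' = x.2),
        classWeightOfDatum₉ F N (theta13LiveOfRecord F N).toStage9Params D g₀ os ⟨K₀ + x.1 + 1, mB x.1, cB x.1⟩ (gB x.1) (K₀ + x.1 + 1) t s') Bad W)
    (h21 : ShellWeightBound l₀
      (fun K => (Finset.univ : Finset (SeqOfRecord F (theta13LiveOfRecord F N).ν (theta13LiveOfRecord F N).τ9.M (gA K) (K₀ + K) (K₀ + K))).map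
        (Function.Embedding.sigmaMk (β := fun K' => SeqOfRecord F (theta13LiveOfRecord F N).ν (theta13LiveOfRecord F N).τ9.M (gA K') (K₀ + K') (K₀ + K')) K))
      (fun _ t x => classWeightOfDatum₉ F N (theta13LiveOfRecord F N).toStage9Params D g₀ os ⟨K₀ + x.1, mA x.1, cA x.1⟩ (gA x.1) (K₀ + x.1) t x.2)
      (fun _ t x => ∑ s' ∈ Finset.univ.filter
          (fun s' : SeqOfRecord F (theta13LiveOfRecord F N).ν (theta13LiveOfRecord F N).τ9.M (gB x.1) (K₀ + x.1 + 1) (K₀ + x.1 + 1) =>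
            truncSeq F (theta13LiveOfRecord F N).ν Nat.one_pos (hR x.1) s' = x.2),
        classWeightOfDatum₉ F N (theta13LiveOfRecord F N).toStage9Params D g₀ os ⟨K₀ + x.1 + 1, mB x.1, cB x.1⟩ (gB x.1) (K₀ + x.1 + 1) t s') shA shB Wsh)
    (hlt : ∀ K, W K + Wsh K < 1)
    (hedge : ∃ δ : ℕ → ℝ, NE7.Core l₀ vol
      (fun K => (Finset.univ : Finset (SeqOfRecord F (theta13LiveOfRecord F N).ν (theta13LiveOfRecord F N).τ9.M (gA K) (K₀ + K) (K₀ + K))).map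
        (Function.Embedding.sigmaMk (β := fun K' => SeqOfRecord F (theta13LiveOfRecord F N).ν (theta13LiveOfRecord F N).τ9.M (gA K') (K₀ + K') (K₀ + K')) K)) Bad
      (fun K t x => classWeightOfDatum₉ F N (theta13LiveOfRecord F N).toStage9Params D g₀ os ⟨K₀ + x.1, mA x.1, cA x.1⟩ (gA x.1) (K₀ + x.1) t x.2 - shA K t x)
      (fun K t x => (∑ s' ∈ Finset.univ.filter
          (fun s' : SeqOfRecord F (theta13LiveOfRecord F N).ν (theta13LiveOfRecord F N).τ9.M (gB x.1) (K₀ + x.1 + 1) (K₀ + x.1 + 1) =>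
            truncSeq F (theta13LiveOfRecord F N).ν Nat.one_pos (hR x.1) s' = x.2),
        classWeightOfDatum₉ F N (theta13LiveOfRecord F N).toStage9Params D g₀ os ⟨K₀ + x.1 + 1, mB x.1, cB x.1⟩ (gB x.1) (K₀ + x.1 + 1) t s') - shB K t x)
        δ ∧ Summable δ) :
    ∃ δ' : ℕ → ℝ, Summable δ' ∧ MatchingModConstants vol l₀ δ' (T4GenFunBounds.schemeZ (D.scheme g₀) os) :=
  matching_scheme_of_coreEdge_classWeights_truncSeq_liveRepin₁₃ F N (theta13OfFamily F N eps0OfRecord₁₃ _ _ _)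
    (hasResidualsOfRecord_theta13OfFamily F N eps0OfRecord₁₃) Nat.one_pos D hD g₀ os K₀ mA mB cA cB gA gB hgA hgB hR hl₀ hvol h20 h21 hlt hedge

open Classical in
/-- **★ THE SAME AT NODE 00's CLOSED v1.7 DATUM OF RECORD** `𝔇ʳᵉᶜ := datumOfRecord₁₃CoPH F N (ofHistoryBlind (ofCured θ₁₃)) (provisos₁₃CoPH_door_theta13LiveOfRecord F N)` (dag-n11-e's
HYPOTHESIS-FREE door proof, `Node00/Record13CoreAtTheta13LiveOfRecord`): node U5d's `RAgree`-truncation as the two-run reading of NODE 00's class weights AT THE RECORD.  DISPLAYED: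
`hR`, `g₀ os K₀ mA mB cA cB gA gB hgA hgB`, `hl₀ hvol`, THE FOUR ESTIMATES — no law, row, selector, proviso or cube-size binder. [cite: Balaban1985UV3, (6) p.257; Balaban1989LargeFieldII, Thm 1 + (0.1) pp.355–356; Balaban1988Convergent, (2.18) p.257, (3.24)–(3.25) p.270; King1986, (3.10) p.656 (bookkeeping)] -/
theorem matching_datumOfRecord₁₃CoPH_theta13LiveOfRecord_door_of_coreEdge_classWeights_truncSeq
    (g₀ : ℕ → ℝ) (os : List (ULoop F)) (K₀ : ℕ) (mA mB : ℕ → ℕ) (cA cB : ℕ → ℝ) (gA gB : ℕ → ℕ → ℝ)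
    (hgA : ∀ K, gA K 0 = g₀ (K₀ + K)) (hgB : ∀ K, gB K 0 = g₀ (K₀ + K + 1))
    (hR : ∀ K, RAgree F (theta13LiveOfRecord F N).ν (gA K) (gB K) (K₀ + K))
    {l₀ vol : ℝ} (hl₀ : 0 ≤ l₀) (hvol : 0 < vol)
    {shA shB : ℕ → ℝ → (Σ K, SeqOfRecord F (theta13LiveOfRecord F N).ν (theta13LiveOfRecord F N).τ9.M (gA K) (K₀ + K) (K₀ + K)) → ℝ}
    {Bad : ℕ → ℝ → Finset (Σ K, SeqOfRecord F (theta13LiveOfRecord F N).ν (theta13LiveOfRecord F N).τ9.M (gA K) (K₀ + K) (K₀ + K))} {W Wsh : ℕ → ℝ}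
    (h20 : RelWeightBound l₀
      (fun K => (Finset.univ : Finset (SeqOfRecord F (theta13LiveOfRecord F N).ν (theta13LiveOfRecord F N).τ9.M (gA K) (K₀ + K) (K₀ + K))).map
        (Function.Embedding.sigmaMk (β := fun K' => SeqOfRecord F (theta13LiveOfRecord F N).ν (theta13LiveOfRecord F N).τ9.M (gA K') (K₀ + K') (K₀ + K')) K))
      (fun _ t x => classWeightOfDatum₉ F N (theta13LiveOfRecord F N).toStage9Params
        (datumOfRecord₁₃CoPH F N (Stage13HParams.ofHistoryBlind F N (Stage13RParams.ofCured F N (theta13LiveOfRecord F N)))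
          (provisos₁₃CoPH_door_theta13LiveOfRecord F N)) g₀ os ⟨K₀ + x.1, mA x.1, cA x.1⟩ (gA x.1) (K₀ + x.1) t x.2)
      (fun _ t x => ∑ s' ∈ Finset.univ.filter
          (fun s' : SeqOfRecord F (theta13LiveOfRecord F N).ν (theta13LiveOfRecord F N).τ9.M (gB x.1) (K₀ + x.1 + 1) (K₀ + x.1 + 1) =>
            truncSeq F (theta13LiveOfRecord F N).ν Nat.one_pos (hR x.1) s' = x.2),
        classWeightOfDatum₉ F N (theta13LiveOfRecord F N).toStage9Params
          (datumOfRecord₁₃CoPH F N (Stage13HParams.ofHistoryBlind F N (Stage13RParams.ofCured F N (theta13LiveOfRecord F N)))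
            (provisos₁₃CoPH_door_theta13LiveOfRecord F N)) g₀ os ⟨K₀ + x.1 + 1, mB x.1, cB x.1⟩ (gB x.1) (K₀ + x.1 + 1) t s') Bad W)
    (h21 : ShellWeightBound l₀
      (fun K => (Finset.univ : Finset (SeqOfRecord F (theta13LiveOfRecord F N).ν (theta13LiveOfRecord F N).τ9.M (gA K) (K₀ + K) (K₀ + K))).map
        (Function.Embedding.sigmaMk (β := fun K' => SeqOfRecord F (theta13LiveOfRecord F N).ν (theta13LiveOfRecord F N).τ9.M (gA K') (K₀ + K') (K₀ + K')) K))
      (fun _ t x => classWeightOfDatum₉ F N (theta13LiveOfRecord F N).toStage9Params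
        (datumOfRecord₁₃CoPH F N (Stage13HParams.ofHistoryBlind F N (Stage13RParams.ofCured F N (theta13LiveOfRecord F N)))
          (provisos₁₃CoPH_door_theta13LiveOfRecord F N)) g₀ os ⟨K₀ + x.1, mA x.1, cA x.1⟩ (gA x.1) (K₀ + x.1) t x.2)
      (fun _ t x => ∑ s' ∈ Finset.univ.filter
          (fun s' : SeqOfRecord F (theta13LiveOfRecord F N).ν (theta13LiveOfRecord F N).τ9.M (gB x.1) (K₀ + x.1 + 1) (K₀ + x.1 + 1) =>
            truncSeq F (theta13LiveOfRecord F N).ν Nat.one_pos (hR x.1) s' = x.2),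
        classWeightOfDatum₉ F N (theta13LiveOfRecord F N).toStage9Params
          (datumOfRecord₁₃CoPH F N (Stage13HParams.ofHistoryBlind F N (Stage13RParams.ofCured F N (theta13LiveOfRecord F N)))
            (provisos₁₃CoPH_door_theta13LiveOfRecord F N)) g₀ os ⟨K₀ + x.1 + 1, mB x.1, cB x.1⟩ (gB x.1) (K₀ + x.1 + 1) t s') shA shB Wsh)
    (hlt : ∀ K, W K + Wsh K < 1)
    (hedge : ∃ δ : ℕ → ℝ, NE7.Core l₀ vol
      (fun K => (Finset.univ : Finset (SeqOfRecord F (theta13LiveOfRecord F N).ν (theta13LiveOfRecord F N).τ9.M (gA K) (K₀ + K) (K₀ + K))).map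
        (Function.Embedding.sigmaMk (β := fun K' => SeqOfRecord F (theta13LiveOfRecord F N).ν (theta13LiveOfRecord F N).τ9.M (gA K') (K₀ + K') (K₀ + K')) K)) Bad
      (fun K t x => classWeightOfDatum₉ F N (theta13LiveOfRecord F N).toStage9Params
        (datumOfRecord₁₃CoPH F N (Stage13HParams.ofHistoryBlind F N (Stage13RParams.ofCured F N (theta13LiveOfRecord F N)))
          (provisos₁₃CoPH_door_theta13LiveOfRecord F N)) g₀ os ⟨K₀ + x.1, mA x.1, cA x.1⟩ (gA x.1) (K₀ + x.1) t x.2 - shA K t x)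
      (fun K t x => (∑ s' ∈ Finset.univ.filter
          (fun s' : SeqOfRecord F (theta13LiveOfRecord F N).ν (theta13LiveOfRecord F N).τ9.M (gB x.1) (K₀ + x.1 + 1) (K₀ + x.1 + 1) =>
            truncSeq F (theta13LiveOfRecord F N).ν Nat.one_pos (hR x.1) s' = x.2),
        classWeightOfDatum₉ F N (theta13LiveOfRecord F N).toStage9Params
          (datumOfRecord₁₃CoPH F N (Stage13HParams.ofHistoryBlind F N (Stage13RParams.ofCured F N (theta13LiveOfRecord F N)))
            (provisos₁₃CoPH_door_theta13LiveOfRecord F N)) g₀ os ⟨K₀ + x.1 + 1, mB x.1, cB x.1⟩ (gB x.1) (K₀ + x.1 + 1) t s') - shB K t x)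
        δ ∧ Summable δ) :
    ∃ δ' : ℕ → ℝ, Summable δ' ∧
      MatchingModConstants vol l₀ δ'
        (T4GenFunBounds.schemeZ ((datumOfRecord₁₃CoPH F N (Stage13HParams.ofHistoryBlind F N (Stage13RParams.ofCured F N (theta13LiveOfRecord F N)))
          (provisos₁₃CoPH_door_theta13LiveOfRecord F N)).scheme g₀) os) :=
  matching_scheme_of_coreEdge_classWeights_truncSeq_theta13LiveOfRecord F N _ (isPrintedAveraged_datumOfRecord₁₃CoPH F N _ _).avgMeasurable
    g₀ os K₀ mA mB cA cB gA gB hgA hgB hR hl₀ hvol h20 h21 hlt hedge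

end AtRecord

section AtThm1CCMW

variable (j : ℕ) (γ ε₀ ε₂₉ B₃ B₃' a₀ a₁ : ℝ)

open Classical in
/-- **★★ N19's :183 ROAD FOR F3's CLASS WEIGHTS AT NODE U5d's `RAgree`-TRUNCATION, AT THE WINDOWED COLLARED K0⁷ WITNESS `θ₁₅ᶜᶜᴹ(j; γ)` — `hres` AND `hM` DISCHARGED** (a member of
K0a's all-numerics family, `rfl`; cube size `L^j > 0`).  DISPLAYED: `hR`, bookkeeping, `hl₀ hvol`, THE FOUR ESTIMATES — no law binder, no window sign `0 < γ ≤ ½`, no `n.Pos`, no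
proviso. [cite: Balaban1985UV3, (6) p.257; Balaban1989LargeFieldII, Thm 1 + (0.1) pp.355–356; Balaban1989LargeFieldI, (0.2)–(0.4) p.176; Balaban1988Convergent, (2.5) p.255, (2.18) p.257; King1986, (3.10) p.656; Balaban1987RG1, Thm 1 p.255 (bookkeeping)] -/
theorem matching_scheme_of_coreEdge_classWeights_truncSeq_theta13OfThm1CCMW
    (D : FiniteEpsData F (SU N)) (hD : D.AvgMeasurable) (g₀ : ℕ → ℝ) (os : List (ULoop F)) (K₀ : ℕ) (mA mB : ℕ → ℕ) (cA cB : ℕ → ℝ) (gA gB : ℕ → ℕ → ℝ)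
    (hgA : ∀ K, gA K 0 = g₀ (K₀ + K)) (hgB : ∀ K, gB K 0 = g₀ (K₀ + K + 1))
    (hR : ∀ K, RAgree F (theta13OfThm1CCMW F N j γ ε₀ ε₂₉ B₃ B₃' a₀ a₁).ν (gA K) (gB K) (K₀ + K))
    {l₀ vol : ℝ} (hl₀ : 0 ≤ l₀) (hvol : 0 < vol)
    {shA shB : ℕ → ℝ → (Σ K, SeqOfRecord F (theta13OfThm1CCMW F N j γ ε₀ ε₂₉ B₃ B₃' a₀ a₁).ν
      (theta13OfThm1CCMW F N j γ ε₀ ε₂₉ B₃ B₃' a₀ a₁).τ9.M (gA K) (K₀ + K) (K₀ + K)) → ℝ}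
    {Bad : ℕ → ℝ → Finset (Σ K, SeqOfRecord F (theta13OfThm1CCMW F N j γ ε₀ ε₂₉ B₃ B₃' a₀ a₁).ν
      (theta13OfThm1CCMW F N j γ ε₀ ε₂₉ B₃ B₃' a₀ a₁).τ9.M (gA K) (K₀ + K) (K₀ + K))} {W Wsh : ℕ → ℝ}
    (h20 : RelWeightBound l₀
      (fun K => (Finset.univ : Finset (SeqOfRecord F (theta13OfThm1CCMW F N j γ ε₀ ε₂₉ B₃ B₃' a₀ a₁).ν
          (theta13OfThm1CCMW F N j γ ε₀ ε₂₉ B₃ B₃' a₀ a₁).τ9.M (gA K) (K₀ + K) (K₀ + K))).map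
        (Function.Embedding.sigmaMk (β := fun K' => SeqOfRecord F (theta13OfThm1CCMW F N j γ ε₀ ε₂₉ B₃ B₃' a₀ a₁).ν
          (theta13OfThm1CCMW F N j γ ε₀ ε₂₉ B₃ B₃' a₀ a₁).τ9.M (gA K') (K₀ + K') (K₀ + K')) K))
      (fun _ t x => classWeightOfDatum₉ F N (theta13OfThm1CCMW F N j γ ε₀ ε₂₉ B₃ B₃' a₀ a₁).toStage9Params D g₀ os ⟨K₀ + x.1, mA x.1, cA x.1⟩ (gA x.1) (K₀ + x.1) t x.2)
      (fun _ t x => ∑ s' ∈ Finset.univ.filter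
          (fun s' : SeqOfRecord F (theta13OfThm1CCMW F N j γ ε₀ ε₂₉ B₃ B₃' a₀ a₁).ν (theta13OfThm1CCMW F N j γ ε₀ ε₂₉ B₃ B₃' a₀ a₁).τ9.M (gB x.1)
              (K₀ + x.1 + 1) (K₀ + x.1 + 1) =>
            truncSeq F (theta13OfThm1CCMW F N j γ ε₀ ε₂₉ B₃ B₃' a₀ a₁).ν (τ9_M_pos_theta13OfThm1CCMW F N j γ ε₀ ε₂₉ B₃ B₃' a₀ a₁) (hR x.1) s' = x.2),
        classWeightOfDatum₉ F N (theta13OfThm1CCMW F N j γ ε₀ ε₂₉ B₃ B₃' a₀ a₁).toStage9Params D g₀ os ⟨K₀ + x.1 + 1, mB x.1, cB x.1⟩ (gB x.1) (K₀ + x.1 + 1) t s')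
      Bad W)
    (h21 : ShellWeightBound l₀
      (fun K => (Finset.univ : Finset (SeqOfRecord F (theta13OfThm1CCMW F N j γ ε₀ ε₂₉ B₃ B₃' a₀ a₁).ν
          (theta13OfThm1CCMW F N j γ ε₀ ε₂₉ B₃ B₃' a₀ a₁).τ9.M (gA K) (K₀ + K) (K₀ + K))).map
        (Function.Embedding.sigmaMk (β := fun K' => SeqOfRecord F (theta13OfThm1CCMW F N j γ ε₀ ε₂₉ B₃ B₃' a₀ a₁).ν
          (theta13OfThm1CCMW F N j γ ε₀ ε₂₉ B₃ B₃' a₀ a₁).τ9.M (gA K') (K₀ + K') (K₀ + K')) K))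
      (fun _ t x => classWeightOfDatum₉ F N (theta13OfThm1CCMW F N j γ ε₀ ε₂₉ B₃ B₃' a₀ a₁).toStage9Params D g₀ os ⟨K₀ + x.1, mA x.1, cA x.1⟩ (gA x.1) (K₀ + x.1) t x.2)
      (fun _ t x => ∑ s' ∈ Finset.univ.filter
          (fun s' : SeqOfRecord F (theta13OfThm1CCMW F N j γ ε₀ ε₂₉ B₃ B₃' a₀ a₁).ν (theta13OfThm1CCMW F N j γ ε₀ ε₂₉ B₃ B₃' a₀ a₁).τ9.M (gB x.1)
              (K₀ + x.1 + 1) (K₀ + x.1 + 1) =>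
            truncSeq F (theta13OfThm1CCMW F N j γ ε₀ ε₂₉ B₃ B₃' a₀ a₁).ν (τ9_M_pos_theta13OfThm1CCMW F N j γ ε₀ ε₂₉ B₃ B₃' a₀ a₁) (hR x.1) s' = x.2),
        classWeightOfDatum₉ F N (theta13OfThm1CCMW F N j γ ε₀ ε₂₉ B₃ B₃' a₀ a₁).toStage9Params D g₀ os ⟨K₀ + x.1 + 1, mB x.1, cB x.1⟩ (gB x.1) (K₀ + x.1 + 1) t s')
      shA shB Wsh)
    (hlt : ∀ K, W K + Wsh K < 1)
    (hedge : ∃ δ : ℕ → ℝ, NE7.Core l₀ vol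
      (fun K => (Finset.univ : Finset (SeqOfRecord F (theta13OfThm1CCMW F N j γ ε₀ ε₂₉ B₃ B₃' a₀ a₁).ν
          (theta13OfThm1CCMW F N j γ ε₀ ε₂₉ B₃ B₃' a₀ a₁).τ9.M (gA K) (K₀ + K) (K₀ + K))).map
        (Function.Embedding.sigmaMk (β := fun K' => SeqOfRecord F (theta13OfThm1CCMW F N j γ ε₀ ε₂₉ B₃ B₃' a₀ a₁).ν
          (theta13OfThm1CCMW F N j γ ε₀ ε₂₉ B₃ B₃' a₀ a₁).τ9.M (gA K') (K₀ + K') (K₀ + K')) K)) Bad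
      (fun K t x => classWeightOfDatum₉ F N (theta13OfThm1CCMW F N j γ ε₀ ε₂₉ B₃ B₃' a₀ a₁).toStage9Params D g₀ os ⟨K₀ + x.1, mA x.1, cA x.1⟩ (gA x.1) (K₀ + x.1) t x.2
        - shA K t x)
      (fun K t x => (∑ s' ∈ Finset.univ.filter
          (fun s' : SeqOfRecord F (theta13OfThm1CCMW F N j γ ε₀ ε₂₉ B₃ B₃' a₀ a₁).ν (theta13OfThm1CCMW F N j γ ε₀ ε₂₉ B₃ B₃' a₀ a₁).τ9.M (gB x.1)
              (K₀ + x.1 + 1) (K₀ + x.1 + 1) =>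
            truncSeq F (theta13OfThm1CCMW F N j γ ε₀ ε₂₉ B₃ B₃' a₀ a₁).ν (τ9_M_pos_theta13OfThm1CCMW F N j γ ε₀ ε₂₉ B₃ B₃' a₀ a₁) (hR x.1) s' = x.2),
        classWeightOfDatum₉ F N (theta13OfThm1CCMW F N j γ ε₀ ε₂₉ B₃ B₃' a₀ a₁).toStage9Params D g₀ os ⟨K₀ + x.1 + 1, mB x.1, cB x.1⟩ (gB x.1) (K₀ + x.1 + 1) t s')
        - shB K t x) δ ∧ Summable δ) :
    ∃ δ' : ℕ → ℝ, Summable δ' ∧ MatchingModConstants vol l₀ δ' (T4GenFunBounds.schemeZ (D.scheme g₀) os) :=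
  matching_scheme_of_coreEdge_classWeights_truncSeq_liveRepin₁₃ F N
    (theta13OfNumerics F N (stage12NumericsOfThm1CCMW F.L j γ ε₀ B₃ B₃' a₀ a₁) ε₂₉ _ _ _) (hasResidualsOfRecord_theta13OfNumerics F N _ ε₂₉)
    (τ9_M_pos_theta13OfThm1CCMW F N j γ ε₀ ε₂₉ B₃ B₃' a₀ a₁) D hD g₀ os K₀ mA mB cA cB gA gB hgA hgB hR hl₀ hvol h20 h21 hlt hedge

end AtThm1CCMW

end Summit.QuantumFields.YangMills.BalabanUVNodes.N19TargetClassWeightsTruncSeq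

end
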